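import Literature.NumberTheory.Sieve.IwaniecAlmostPrimesProp2Lower
import HarnessLib

/-!
# Iwaniec (1978): display (1) for `n² + 1` (`card_P2_lower`) from Proposition 2 — PROVED glue

H. Iwaniec, *Almost-primes represented by quadratic polynomials*, Invent. Math. **47** (1978)
171–188 [cite: IwaniecInventiones1978, Theorem p. 172 (1), §2 p. 173 and §6 p. 187].
The first file of this topic (`IwaniecAlmostPrimes.lean`) vendors display (1) of the Theorem for
`G = n² + 1` as the named fact `card_P2_lower`:
`#{1 ≤ n ≤ x : Ω(n² + 1) ≤ 2} > (1/77) Γ x / log x` for all large `x`.  The sequels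
(`…WeightedSum`, `…Numerics`, `…Conclusion`, `…Prop2`, `…Prop2Lower`) prove display (2)
(`weightedSum_lower`: `W(𝒜, x^{1/5}) > (1/77) Γ x / log x`) and parity.S19 from Proposition 2, and
Proposition 2 from `lemma2_bilinearSieve` and `proposition1`.

Display (1) does NOT follow from `weightedSum_lower` as stated (same constant `1/77` on both
sides, while `#{n ≤ x : n² + 1 = P₂} ≥ W(𝒜, z) − 1 − 7x z^{-1/2}`, p. 173); the printed proof has
slack — the §6 evaluation gives `W(𝒜, z) > c Γ x / log x` with a constant `c` STRICTLY larger
than `1/77` (p. 187), which absorbs the `O(x z^{-1/2})` non-squarefree terms.  This file makes that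
explicit and PROVES:

* `weightedSum_le_card_Icc` — p. 173 localised to `n ≤ x`:
  `W(𝒜, z) ≤ #{1 ≤ n ≤ x : Ω(n² + 1) ≤ 2} + 1 + 7x/√z` (Lemma 1 + the non-squarefree bound);
* `exists_gt_weightedSum_ge_of_prop2_const` — the §6 assembly of `IwaniecAlmostPrimesWeightedSum`
  (`weightedSum_lower_of_prop2_const`) run with its slack kept:
  `∃ c > Γ/77, ∀ᶠ x, c x / log x ≤ W(𝒜, x^{1/5})`;
* `card_P2_lower_of_exists_gt` — `(∃ c > Γ/77, ∀ᶠ x, c x/log x ≤ W(𝒜, x^{1/5})) → card_P2_lower`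
  (since `log x = o(x^{1/10})`);
* **`card_P2_lower_of_proposition2 : proposition2_upper → proposition2_lower → card_P2_lower`**,
  `card_P2_lower_of_prop2_const` (constant-level lower half suffices) and
  **`card_P2_lower_of_lemma2_of_proposition1 : lemma2_bilinearSieve → proposition1 →
  card_P2_lower`**;
* `setOf_isAtMostAlmostPrime_two_sq_add_one_infinite_of_card_P2_lower` — (1) ⟹ parity.S19.

So `card_P2_lower` rests on exactly the same two named inputs as `weightedSum_lower` and
parity.S19: Iwaniec's bilinear-remainder linear sieve (`lemma2_bilinearSieve`, Acta Arith. 37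
(1980) Thm 1) and the dispersion estimate `proposition1` (p. 176).
-/

open Filter Finset Real MeasureTheory intervalIntegral
open scoped Topology

noncomputable section

namespace Literature.NumberTheory.Sieve.Iwaniec1978

/-! ### p. 173 localised: `W(𝒜, z) ≤ #{n ≤ x : n² + 1 = P₂} + 1 + 7x/√z` -/

/-- **Iwaniec 1978, p. 173, `#{a ∈ 𝒜 : a = P₂} ≥ W(𝒜, z) − O(x z^{-1/2})` — PROVED, local form.**
For `x > 1`, `z ≥ 2`: `W(𝒜, z) ≤ #{1 ≤ n ≤ x : Ω(n² + 1) ≤ 2} + 1 + 7x/√z`.  (Each weight is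
`≤ 1`; a positive weight at `a = n² + 1 ≤ x²` (`n < ⌊x⌋`; the single `n = ⌊x⌋` is discarded)
forces `ω(a) ≤ 2` by Lemma 1 with `λ = 2`, and then either `a` is squarefree, so
`Ω(a) = ω(a) ≤ 2`, or `a` is counted by `card_nonSquarefree_le`.)
[cite: IwaniecInventiones1978, §2 p. 173] -/
theorem weightedSum_le_card_Icc {x z : ℝ} (hx : 1 < x) (hz : 2 ≤ z) :
    weightedSum x z ≤
      ((open scoped Classical in
        (Finset.Icc 1 ⌊x⌋₊).filter fun n : ℕ => Nat.IsAtMostAlmostPrime 2 (n ^ 2 + 1)).card : ℝ) +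
        1 + 7 * x / Real.sqrt z := by
  classical
  set T := (Finset.Icc 1 ⌊x⌋₊).filter fun n : ℕ => Nat.IsAtMostAlmostPrime 2 (n ^ 2 + 1)
    with hTdef
  unfold weightedSum
  set F := (Finset.Icc 1 ⌊x⌋₊).filter (fun n : ℕ => Nat.Coprime (n ^ 2 + 1) (primesProdBelow z))
    with hF
  set N := (Finset.Icc 1 ⌊x⌋₊).filter fun n : ℕ =>
      Nat.Coprime (n ^ 2 + 1) (primesProdBelow z) ∧ ¬ Squarefree (n ^ 2 + 1) with hN
  have hNle : (N.card : ℝ) ≤ 7 * x / Real.sqrt z := card_nonSquarefree_le hx.le hz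
  set F₂ := F.filter fun n : ℕ => 0 < richertWeight 2 x (n ^ 2 + 1) with hF₂
  have h1 : ∑ n ∈ F, richertWeight 2 x (n ^ 2 + 1) ≤
      ∑ n ∈ F, (if 0 < richertWeight 2 x (n ^ 2 + 1) then (1 : ℝ) else 0) := by
    refine Finset.sum_le_sum fun n _ => ?_
    split_ifs with h
    · exact richertWeight_le_one (by norm_num) hx _
    · exact not_lt.mp h
  have h2 : ∑ n ∈ F, (if 0 < richertWeight 2 x (n ^ 2 + 1) then (1 : ℝ) else 0) = F₂.card := by
    rw [Finset.sum_boole]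
  have hx0 : 0 < x := by linarith
  have h3 : F₂ ⊆ insert ⌊x⌋₊ (T ∪ N) := by
    intro n hn
    rw [hF₂, hF, Finset.mem_filter, Finset.mem_filter, Finset.mem_Icc] at hn
    obtain ⟨⟨⟨hn1, hnx⟩, hcop⟩, hw⟩ := hn
    rw [Finset.mem_insert, Finset.mem_union]
    rcases eq_or_ne n ⌊x⌋₊ with h | hne
    · exact Or.inl h
    right
    have hnlt : n < ⌊x⌋₊ := lt_of_le_of_ne hnx hne
    have hle : ((n ^ 2 + 1 : ℕ) : ℝ) ≤ x ^ (2 : ℝ) := by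
      rw [Real.rpow_two]
      have h' : (n : ℝ) + 1 ≤ x := by
        have h1' : ((n + 1 : ℕ) : ℝ) ≤ ⌊x⌋₊ := by exact_mod_cast hnlt
        have hfl : (⌊x⌋₊ : ℝ) ≤ x := Nat.floor_le hx0.le
        push_cast at h1'
        linarith
      have hn0 : (0 : ℝ) ≤ n := Nat.cast_nonneg n
      push_cast
      nlinarith
    have hω := cardDistinctFactors_le_two_of_richertWeight_pos (lam := 2) le_rfl (by norm_num) hx
      (Nat.succ_ne_zero _) hle hw
    by_cases hsf : Squarefree (n ^ 2 + 1)
    · left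
      rw [hTdef, Finset.mem_filter, Finset.mem_Icc]
      refine ⟨⟨hn1, hnx⟩, Nat.succ_ne_zero _, ?_⟩
      rw [← (ArithmeticFunction.cardDistinctFactors_eq_cardFactors_iff_squarefree
        (Nat.succ_ne_zero _)).mpr hsf]
      exact hω
    · right
      rw [hN, Finset.mem_filter, Finset.mem_Icc]
      exact ⟨⟨hn1, hnx⟩, hcop, hsf⟩
  have h4 : (F₂.card : ℝ) ≤ T.card + N.card + 1 := by
    have : F₂.card ≤ T.card + N.card + 1 :=
      calc F₂.card ≤ (insert ⌊x⌋₊ (T ∪ N)).card := Finset.card_le_card h3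
        _ ≤ (T ∪ N).card + 1 := Finset.card_insert_le _ _
        _ ≤ T.card + N.card + 1 := by gcongr; exact Finset.card_union_le _ _
    exact_mod_cast this
  calc ∑ n ∈ F, richertWeight 2 x (n ^ 2 + 1) ≤ F₂.card := h1.trans_eq h2
    _ ≤ T.card + N.card + 1 := h4
    _ ≤ T.card + 1 + 7 * x / Real.sqrt z := by linarith

/-! ### (1) from a weighted-sum bound with a constant `> 1/77` -/

/-- **Display (1) from (2)-with-slack — PROVED.**  If `W(𝒜, x^{1/5}) ≥ c x / log x` for all large
`x` with some `c > Γ/77`, then `#{1 ≤ n ≤ x : Ω(n² + 1) ≤ 2} > (Γ/77) x / log x` for all large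
`x` (`card_P2_lower`): by `weightedSum_le_card_Icc`,
`#{…} ≥ W(𝒜, x^{1/5}) − 1 − 7x^{9/10}`, and `1 + 7x^{9/10} < (c − Γ/77) x / log x` eventually
since `log x = o(x^{1/10})`.  This is the last paragraph of the reduction on p. 173 with the
constants of p. 187. [cite: IwaniecInventiones1978, §2 p. 173] -/
theorem card_P2_lower_of_exists_gt
    (h : ∃ c : ℝ, gamma / 77 < c ∧
      ∀ᶠ x : ℝ in atTop, c * x / Real.log x ≤ weightedSum x (x ^ (1 / 5 : ℝ))) :
    card_P2_lower := by
  obtain ⟨c, hc, hW⟩ := h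
  set d : ℝ := c - gamma / 77 with hd
  have hd0 : 0 < d := by rw [hd]; linarith
  set δ : ℝ := d / 16 with hδ
  have hδ0 : 0 < δ := by positivity
  have hlog : ∀ᶠ x : ℝ in atTop, ‖Real.log x‖ ≤ δ * ‖x ^ (1 / 10 : ℝ)‖ :=
    (Asymptotics.isLittleO_iff.mp (isLittleO_log_rpow_atTop (by norm_num : (0 : ℝ) < 1 / 10))) hδ0
  unfold card_P2_lower
  filter_upwards [hW, hlog, eventually_ge_atTop (32 : ℝ)] with x hWx hlogx hx32
  have hx1 : 1 < x := by linarith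
  have hx0 : 0 < x := by linarith
  set u : ℝ := x ^ (1 / 10 : ℝ) with hu
  have hu1 : 1 ≤ u := Real.one_le_rpow hx1.le (by norm_num)
  have hu0 : 0 < u := by linarith
  have hxu : u ^ 10 = x := by
    rw [hu, ← Real.rpow_mul_natCast hx0.le]; norm_num
  have hz2 : x ^ (1 / 5 : ℝ) = u ^ 2 := by
    rw [hu, ← Real.rpow_mul_natCast hx0.le]; norm_num
  have hsqrt : Real.sqrt (x ^ (1 / 5 : ℝ)) = u := by
    rw [hz2, Real.sqrt_sq hu0.le]
  have h2z : (2 : ℝ) ≤ x ^ (1 / 5 : ℝ) := by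
    rw [one_div, Real.le_rpow_inv_iff_of_pos (by norm_num) hx0.le (by norm_num)]
    norm_num; linarith
  have hLx : Real.log x ≤ δ * u := by
    rw [Real.norm_eq_abs, Real.norm_eq_abs, abs_of_nonneg (Real.log_nonneg hx1.le),
      abs_of_nonneg (Real.rpow_nonneg hx0.le _)] at hlogx
    exact hlogx
  have hL0 : 0 < Real.log x := Real.log_pos hx1
  have hle := weightedSum_le_card_Icc hx1 h2z
  rw [hsqrt] at hle
  have hxu' : 7 * x / u = 7 * u ^ 9 := by
    rw [← hxu]; field_simp
  have h9 : 1 ≤ u ^ 9 := one_le_pow₀ hu1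
  -- `1 + 7u⁹ < d x / log x` because `log x ≤ δ u = (d/16) u` and `x = u¹⁰`
  have hkey : 1 + 7 * x / u < d * x / Real.log x := by
    rw [hxu', lt_div_iff₀ hL0]
    have hpos : 0 ≤ 1 + 7 * u ^ 9 := by positivity
    calc (1 + 7 * u ^ 9) * Real.log x ≤ (1 + 7 * u ^ 9) * (δ * u) :=
          mul_le_mul_of_nonneg_left hLx hpos
      _ ≤ (8 * u ^ 9) * (δ * u) := by
          apply mul_le_mul_of_nonneg_right _ (by positivity)
          linarith
      _ = d / 2 * u ^ 10 := by rw [hδ]; ring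
      _ < d * u ^ 10 := by nlinarith [pow_pos hu0 10]
      _ = d * x := by rw [hxu]
  have hsplit : c * x / Real.log x = gamma / 77 * x / Real.log x + d * x / Real.log x := by
    rw [hd]; ring
  linarith [hWx, hle, hkey, hsplit]

/-! ### §6 with its slack kept: `W(𝒜, x^{1/5}) ≥ c x / log x` with `c > Γ/77` -/

/-- **§6 of Iwaniec 1978 with the slack kept — PROVED modulo the listed inputs.**  From
Proposition 2 (upper half and constant-level lower half), the linear-sieve functions `F, f`, the
Mertens-type asymptotics `∑_{p ≤ t} ρ(p)/p = log log t + b + o(1)` and `V(z) log z → 2Γ e^{-γ}`,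
and the numerical inequality `e^γ/770 < f(16/3) − T3 − T4 − T5` of p. 187: there is a constant
`c > Γ/77` with `W(𝒜, x^{1/5}) ≥ c x / log x` for all large `x`.  (Same proof as
`weightedSum_lower_of_prop2_const`, whose choice of `ε` already leaves the margin
`c = (Γ/77)(1 + κ/2)`, `κ = 385 e^{-γ} σ`, `σ` the numerical slack.)
[cite: IwaniecInventiones1978, §6 pp. 186–187] -/
theorem exists_gt_weightedSum_ge_of_prop2_const (h2u : proposition2_upper)
    (h2l : proposition2_lower_const)
    {F f : ℝ → ℝ} (hFf : IsLinearSieveFunctions F f) (hP : RhoMertens)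
    (hV : Tendsto (fun z : ℝ => densityProd z * Real.log z) atTop
      (𝓝 (hardyLittlewoodEConst * Real.exp (-Real.eulerMascheroniConstant))))
    (hnum : Real.exp Real.eulerMascheroniConstant / 770 <
      f (16 / 3)
        - (∫ u in (1 / 5 : ℝ)..(1 / 2), (1 - 2 * u) * F ((16 / 15 - u) / u) * ((1 / 5) / u) / u)
        - (∫ u in (1 / 5 : ℝ)..(1 / 2), F (5 * (16 / 15 - u)))
        - (∫ u in (1 / 2 : ℝ)..1, (1 - u) * F (5 * (16 / 15 - u)) / u)) :
    ∃ c : ℝ, gamma / 77 < c ∧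
      ∀ᶠ x : ℝ in atTop, c * x / Real.log x ≤ weightedSum x (x ^ (1 / 5 : ℝ)) := by
  set T3 := ∫ u in (1 / 5 : ℝ)..(1 / 2), (1 - 2 * u) * F ((16 / 15 - u) / u) * ((1 / 5) / u) / u
  set T4 := ∫ u in (1 / 5 : ℝ)..(1 / 2), F (5 * (16 / 15 - u))
  set T5 := ∫ u in (1 / 2 : ℝ)..1, (1 - u) * F (5 * (16 / 15 - u)) / u
  set θ := Real.exp Real.eulerMascheroniConstant / 770 with hθ
  set σ := f (16 / 3) - T3 - T4 - T5 - θ with hσ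
  have hσ0 : 0 < σ := by rw [hσ]; linarith
  obtain ⟨C, hC⟩ := weightedSum_ge_of_prop2_const h2u h2l hFf
  set C' := max C 0 with hC'
  have hC'0 : 0 ≤ C' := le_max_right _ _
  -- choice of `ε`
  set ε := min (1 / 4 : ℝ) (σ / (8 * (C' + 1))) with hεdef
  have hε0 : 0 < ε := by rw [hεdef]; positivity
  have hε4 : ε ≤ 1 / 4 := min_le_left _ _
  have hCε : C' * ε ≤ σ / 8 := by
    have h1 : ε ≤ σ / (8 * (C' + 1)) := min_le_right _ _
    have h2 : C' * ε ≤ (C' + 1) * ε := by nlinarith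
    calc C' * ε ≤ (C' + 1) * ε := h2
      _ ≤ (C' + 1) * (σ / (8 * (C' + 1))) := by gcongr
      _ = σ / 8 := by field_simp
  obtain ⟨x₀, hx₀⟩ := hC ε hε0 hε4
  -- the three main-sum bounds with `δ = σ/8`
  have hδ : 0 < σ / 8 := by positivity
  have hA := MA_le hP hFf hδ
  have hB := MB_le hP hFf hδ
  have h2 := M2_le hP hFf hε0 hε4 hδ
  have hT5 := T5_trunc_le hFf hε0 (by linarith)
  -- the density: eventually `V(z) log z ≥ (1 − η) C₀ e^{-γ}`
  set C₀ := hardyLittlewoodEConst * Real.exp (-Real.eulerMascheroniConstant) with hC₀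
  have hHL : hardyLittlewoodEConst = 2 * gamma := by rw [gamma]; ring
  have hC₀pos : 0 < C₀ := by
    rw [hC₀, hHL]; exact mul_pos (by linarith [gamma_pos]) (Real.exp_pos _)
  set κ := 385 * Real.exp (-Real.eulerMascheroniConstant) * σ with hκ
  have hκ0 : 0 < κ := by positivity
  set η := κ / (2 * (1 + κ)) with hη
  have hη0 : 0 < η := by positivity
  have hη1 : η < 1 := by
    rw [hη, div_lt_one (by positivity)]; nlinarith
  have hVev : ∀ᶠ x : ℝ in atTop,
      (1 - η) * C₀ ≤ densityProd (x ^ (1 / 5 : ℝ)) * Real.log (x ^ (1 / 5 : ℝ)) := by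
    have ht := hV.comp (tendsto_rpow_atTop (by norm_num : (0 : ℝ) < 1 / 5))
    have hlt : (1 - η) * C₀ < C₀ := by nlinarith
    exact ht.eventually_const_le hlt
  -- the constant: `c = 5 (1 − η) C₀ (θ + σ/2) = (Γ/77)(1 + κ/2) > Γ/77`
  have hkey : gamma / 77 < (1 - η) * C₀ / (1 / 5) * (θ + σ / 2) := by
    have hexp :
        Real.exp (-Real.eulerMascheroniConstant) * Real.exp Real.eulerMascheroniConstant = 1 := by
      rw [← Real.exp_add]; simp
    have h1 : (1 - η) * (1 + κ) = 1 + κ / 2 := by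
      rw [hη]; field_simp; ring
    have hE := Real.exp_pos (-Real.eulerMascheroniConstant)
    rw [hC₀, hHL, hθ]
    have hg := gamma_pos
    have : (1 - η) * (2 * gamma * Real.exp (-Real.eulerMascheroniConstant)) / (1 / 5) *
        (Real.exp Real.eulerMascheroniConstant / 770 + σ / 2) =
        gamma / 77 * ((1 - η) * (1 + κ)) := by
      rw [hκ]; linear_combination ((1 - η) * gamma / 77) * hexp
    rw [this, h1]
    have hpos : 0 < gamma / 77 * (κ / 2) := by positivity
    have hexpand : gamma / 77 * (1 + κ / 2) = gamma / 77 + gamma / 77 * (κ / 2) := by ring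
    rw [hexpand]
    linarith
  refine ⟨(1 - η) * C₀ / (1 / 5) * (θ + σ / 2), hkey, ?_⟩
  -- assemble
  filter_upwards [hA, hB, h2, hVev, eventually_ge_atTop x₀, eventually_gt_atTop (1 : ℝ)]
    with x hxA hxB hx2 hxV hxx₀ hx1
  have hx0 : 0 < x := by linarith
  have hL0 : 0 < Real.log x := Real.log_pos hx1
  have hmain := hx₀ x hxx₀
  set V := densityProd (x ^ (1 / 5 : ℝ)) with hVx
  have hlogz : Real.log (x ^ (1 / 5 : ℝ)) = (1 / 5) * Real.log x := Real.log_rpow hx0 _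
  have hV0 : 0 ≤ V := by
    have := hxV
    rw [hlogz] at this
    have h1 : 0 < (1 - η) * C₀ := mul_pos (by linarith) hC₀pos
    by_contra hneg
    rw [not_le] at hneg
    have : V * (1 / 5 * Real.log x) < 0 := mul_neg_of_neg_of_pos hneg (by positivity)
    linarith
  -- lower bound for the bracket
  have hbr : f (16 / 3) - T3 - T4 - T5 - σ / 2 ≤
      f (16 / 3)
        - ∑ p ∈ primesIn (x ^ (1 / 5 : ℝ)) (x ^ (1 / 2 : ℝ)),
            (1 - 2 * Real.log p / Real.log x) * (rho p : ℝ) / p *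
              F (Real.log (x ^ (16 / 15 : ℝ) / p) / Real.log p) *
                (Real.log (x ^ (1 / 5 : ℝ)) / Real.log p)
        - ∑ p ∈ primesIn (x ^ (1 / 5 : ℝ)) (x ^ (1 / 2 : ℝ)),
            Real.log p / Real.log x * (rho p : ℝ) / p *
              F (Real.log (x ^ (16 / 15 : ℝ) / p) / Real.log (x ^ (1 / 5 : ℝ)))
        - ∑ p ∈ primesIn (x ^ (1 / 2 : ℝ)) (x ^ (1 - ε)),
            (1 - Real.log p / Real.log x) * (rho p : ℝ) / p *
              F (Real.log (x ^ (16 / 15 : ℝ) / p) / Real.log (x ^ (1 / 5 : ℝ)))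
        - C * ε := by
    have hCC : C * ε ≤ C' * ε := mul_le_mul_of_nonneg_right (le_max_left _ _) hε0.le
    linarith [hxA, hxB, hx2, hT5, hCε, hCC]
  have hW : V * x * (f (16 / 3) - T3 - T4 - T5 - σ / 2) ≤ weightedSum x (x ^ (1 / 5 : ℝ)) :=
    le_trans (mul_le_mul_of_nonneg_left hbr (mul_nonneg hV0 hx0.le)) hmain
  -- `f(16/3) − T3 − T4 − T5 − σ/2 = θ + σ/2`
  have hval : f (16 / 3) - T3 - T4 - T5 - σ / 2 = θ + σ / 2 := by rw [hσ]; ring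
  rw [hval] at hW
  -- compare `V x (θ + σ/2)` with `c x / log x`
  have hVlow : (1 - η) * C₀ / ((1 / 5) * Real.log x) ≤ V := by
    rw [div_le_iff₀ (by positivity), ← hlogz]; exact hxV
  calc (1 - η) * C₀ / (1 / 5) * (θ + σ / 2) * x / Real.log x
        = (1 - η) * C₀ / (1 / 5) * (θ + σ / 2) * (x / Real.log x) := by ring
    _ = (1 - η) * C₀ / ((1 / 5) * Real.log x) * x * (θ + σ / 2) := by
        field_simp
    _ ≤ V * x * (θ + σ / 2) :=
        mul_le_mul_of_nonneg_right (mul_le_mul_of_nonneg_right hVlow hx0.le) (by positivity)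
    _ ≤ weightedSum x (x ^ (1 / 5 : ℝ)) := hW

/-! ### Assembly: (1) from Proposition 2, and from Lemma 2 + Proposition 1 -/

/-- **Display (1) for `n² + 1` from Proposition 2 (upper half and constant-level lower half) —
PROVED**, the pair `(F, f)` being supplied by `exists_isLinearSieveFunctions`, the Mertens inputs
by `tendsto_sum_primesLE_rho_div_sub_loglog` and `tendsto_densityProd_mul_log`, the numerics by
`IsLinearSieveFunctions.numerics`. [cite: IwaniecInventiones1978, Theorem p. 172 (1)] -/
theorem card_P2_lower_of_prop2_const (h2u : proposition2_upper) (h2l : proposition2_lower_const) :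
    card_P2_lower := by
  obtain ⟨F, f, hFf⟩ := exists_isLinearSieveFunctions
  exact card_P2_lower_of_exists_gt
    (exists_gt_weightedSum_ge_of_prop2_const h2u h2l hFf tendsto_sum_primesLE_rho_div_sub_loglog
      tendsto_densityProd_mul_log hFf.numerics)

/-- **Display (1) for `n² + 1` from Proposition 2 — PROVED:**
`proposition2_upper → proposition2_lower → card_P2_lower`.
[cite: IwaniecInventiones1978, Theorem p. 172 (1)] -/
theorem card_P2_lower_of_proposition2 (h2u : proposition2_upper) (h2l : proposition2_lower) :
    card_P2_lower :=
  card_P2_lower_of_prop2_const h2u h2l.const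

/-- **Display (1) for `n² + 1` from Lemma 2 and Proposition 1 — PROVED:**
`lemma2_bilinearSieve → proposition1 → card_P2_lower` (Proposition 2 by
`proposition2_upper_of_lemma2_of_proposition1`, `proposition2_lower_const_of_lemma2_of_proposition1`).
So display (1), like (2) and parity.S19, rests on exactly the two named inputs
`lemma2_bilinearSieve` (Acta Arith. 37 (1980), Theorem 1) and `proposition1` (p. 176).
[cite: IwaniecInventiones1978, Theorem p. 172 (1)] -/
theorem card_P2_lower_of_lemma2_of_proposition1 (h2 : lemma2_bilinearSieve) (h1 : proposition1) :
    card_P2_lower :=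
  card_P2_lower_of_prop2_const (proposition2_upper_of_lemma2_of_proposition1 h2 h1)
    (proposition2_lower_const_of_lemma2_of_proposition1 h2 h1)

/-! ### (1) ⟹ parity.S19 -/

/-- **Display (1) implies the qualitative Theorem for `n² + 1` (parity.S19) — PROVED:** if
`#{1 ≤ n ≤ x : Ω(n² + 1) ≤ 2} > (Γ/77) x / log x` for all large `x`, then `Ω(n² + 1) ≤ 2` for
infinitely many `n` (`Γ > 0` and `x / log x → ∞`). [cite: IwaniecInventiones1978, Theorem p. 172] -/
theorem setOf_isAtMostAlmostPrime_two_sq_add_one_infinite_of_card_P2_lower (h : card_P2_lower) :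
    setOf_isAtMostAlmostPrime_two_sq_add_one_infinite := by
  classical
  intro hfin
  set T := hfin.toFinset with hTdef
  set K : ℝ := T.card + 1 with hK
  have hK0 : 0 < K := by positivity
  have hc : 0 < gamma / 77 := div_pos gamma_pos (by norm_num)
  set δ : ℝ := gamma / 77 / K with hδ
  have hδ0 : 0 < δ := by positivity
  have hlog : ∀ᶠ x : ℝ in atTop, ‖Real.log x‖ ≤ δ * ‖x‖ :=
    (Asymptotics.isLittleO_iff.mp Real.isLittleO_log_id_atTop) hδ0
  obtain ⟨x, hx2, hlogx, hx⟩ := ((eventually_ge_atTop (2 : ℝ)).and (hlog.and h)).exists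
  have hx1 : 1 < x := by linarith
  have hx0 : 0 < x := by linarith
  have hL0 : 0 < Real.log x := Real.log_pos hx1
  have hLx : Real.log x ≤ δ * x := by
    rw [Real.norm_eq_abs, Real.norm_eq_abs, abs_of_nonneg (Real.log_nonneg hx1.le),
      abs_of_nonneg hx0.le] at hlogx
    exact hlogx
  -- the counted set is contained in `T`
  have hsub : ((Finset.Icc 1 ⌊x⌋₊).filter fun n : ℕ => Nat.IsAtMostAlmostPrime 2 (n ^ 2 + 1)) ⊆
      T := by
    intro n hn
    rw [Finset.mem_filter] at hn
    exact hfin.mem_toFinset.mpr hn.2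
  have hcard : (((Finset.Icc 1 ⌊x⌋₊).filter
      fun n : ℕ => Nat.IsAtMostAlmostPrime 2 (n ^ 2 + 1)).card : ℝ) ≤ T.card := by
    exact_mod_cast Finset.card_le_card hsub
  -- but `(Γ/77) x / log x ≥ (Γ/77)/δ = K = #T + 1`
  have hbig : K ≤ gamma / 77 * x / Real.log x := by
    rw [le_div_iff₀ hL0]
    calc K * Real.log x ≤ K * (δ * x) := mul_le_mul_of_nonneg_left hLx hK0.le
      _ = gamma / 77 * x := by rw [hδ]; field_simp
  have hx' := lt_of_le_of_lt hbig hx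
  have : (T.card : ℝ) + 1 ≤ T.card := by
    rw [hK] at hx'
    exact le_trans hx'.le (by convert hcard using 2)
  linarith

end Literature.NumberTheory.Sieve.Iwaniec1978

end
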